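import Summits.Ventures.LatticeQCDFlow.Scaling.SimulatedTemperingExactLevelLaw
import Summits.Ventures.LatticeQCDFlow.Scaling.ParallelTemperingReversibleSampler

/-!
HONEST FRAMING: exact (Metropolis-corrected) sampling algorithms for lattice gauge theory; figures
of merit are autocorrelation/cost numbers at stated couplings and volumes; no continuum-physics
claim.

# SimulatedTemperingPerfectWithinLevel — EVEN PERFECT WITHIN-LEVEL SAMPLING (AN INDEPENDENT DRAW FROM `μ_{β_k}`
# AT EVERY STEP — THE IDEAL OF A TRIVIALIZING FLOW) LEAVES THE COUPLING INDEX OF SIMULATED TEMPERING / REPLICA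
# EXCHANGE EXACTLY AS DIFFUSIVE: `ρ_lev(1) = 1 − 3ā_K/(K(K+2))`, `τ_int ≥ e·m·(b−a)²/96 − ½` (lean-2 GEN-14, ours)

Venture-side (OURS).  Cell `lqcd-flow` (pub-lqcd), unit `pub-lqcd-lean-2-g14`, 2026-08-24.  The cell's subject is
flow-based EXACT samplers; a perfect trivializing map at coupling `β_k` would turn the within-level update into an
INDEPENDENT draw from `μ_{β_k}` — the constant kernel `Kernel.const Ω μ_{β_k}` ("heat bath of the whole
lattice").  This file records that this best case is an instance of GEN-14's laws and changes nothing for the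
coupling index: the constant kernel is Markov, `μ_{β_k}`-invariant and `μ_{β_k}`-REVERSIBLE (`invariant_kernelConst`,
`isReversible_kernelConst`), so the simulated-tempering sampler with perfect within-level sampling,
`stPerfectWithinLevel = stWithinLevel (k ↦ const μ_{β_k})`, has EXACTLY the level law of
`Scaling/SimulatedTemperingExactLevelLaw` and, in random scan, the `τ_int` floor of
`Scaling/SimulatedTemperingAlgorithm`; the same for replica exchange with every replica redrawn independently at
its own coupling (`ptPerfectUpdate = ptRandomUpdate (k ↦ const μ_{β_k})`, `Scaling/ParallelTemperingReversibleSampler`).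

## What is proved

* §1 (general `E`, probability `π`): **`invariant_kernelConst`** (`Kernel.Invariant (const E π) π`),
  **`isReversible_kernelConst`** (`∫⁻_A π(B) dπ = π(A)π(B)` is symmetric).
* §2 `stPerfectWithinLevel X μ β K`; **`stPerfect_level_lagOneAutocorr_eq`** — for `stPerfectWithinLevel ∘ₖ L`:
  `ρ_lev(1) = 1 − 3ā_K/(K(K+2))` (`K ≥ 1`); **`stPerfect_level_tauInt_ge_kfree`** — random scan
  `t·L + (1−t)·stPerfectWithinLevel`, uniform ladder, floor `0 < m ≤ Var_{μ_u}(X)` on `[a,b]`, summable level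
  autocorrelations with `ρ(1) < 1`: `e·m·(b−a)²/96 − ½ ≤ τ_int(level)` for every `K ≥ 1`.
* §3 `ptPerfectUpdate`; **`ptPerfect_level_tauInt_ge_kfree`** — replica exchange `t·ptSwapKernel + (1−t)·ptPerfectUpdate`:
  `e·m·(b−a)²/48 − ½ ≤ τ_int(tag)`.

Reading (no numerics implied): the tempering bottleneck is orthogonal to the quality of the within-level
sampler — a perfect flow at every rung buys nothing for the diffusion of the coupling index, whose cost floor
`Ω(heat capacity × window²)` per decorrelation stands (and is attained, `Scaling/SimulatedTemperingExactLadderLaws`).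
NOT CLAIMED: anything about imperfect flows beyond what GEN-11/12/13 already priced; anything measured.
Literature grade (cell rule): bookkeeping corollary, NEW TYPING; nothing cited as a fact.
-/

noncomputable section

open MeasureTheory ProbabilityTheory Set Filter Finset
open Summit.Ventures.LatticeQCDFlow.Scoring
open scoped ENNReal

namespace Summit.Ventures.LatticeQCDFlow.Scaling

/-! ## §1 The constant kernel: independent resampling from the target -/

section Const

variable {E : Type*} [MeasurableSpace E] (π : Measure E) [IsProbabilityMeasure π]

/-- **Independent resampling from `π` leaves `π` invariant.** [folklore] -/
theorem invariant_kernelConst : Kernel.Invariant (Kernel.const E π) π := by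
  unfold Kernel.Invariant
  ext A hA
  rw [Measure.bind_apply hA (Kernel.aemeasurable _)]
  simp only [Kernel.const_apply, lintegral_const, measure_univ, mul_one]

omit [IsProbabilityMeasure π] in
/-- **Independent resampling from `π` is `π`-reversible**: `∫⁻_A π(B) dπ = π(A)·π(B)`. [folklore] -/
theorem isReversible_kernelConst : Kernel.IsReversible (Kernel.const E π) π := by
  intro A B hA hB
  simp only [Kernel.const_apply, lintegral_const, Measure.restrict_apply MeasurableSet.univ, Set.univ_inter]
  rw [mul_comm]

end Const

/-! ## §2 Simulated tempering with perfect within-level sampling -/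

section ST

variable {Ω : Type*} [MeasurableSpace Ω]

/-- **Perfect within-level sampling**: at level `k` replace the configuration by an independent draw from
`μ_{β_k}` (the ideal of a trivializing flow at coupling `β_k`). [ours] -/
def stPerfectWithinLevel (X : Ω → ℝ) (μ : Measure Ω) (β : ℕ → ℝ) (K : ℕ) :
    Kernel (Fin (K + 1) × Ω) (Fin (K + 1) × Ω) :=
  stWithinLevel fun k : Fin (K + 1) => Kernel.const Ω (μ.tilted fun x => β k * X x)

variable {X : Ω → ℝ} {μ : Measure Ω} [IsProbabilityMeasure μ] {β : ℕ → ℝ} {K : ℕ}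

/-- **EVEN WITH PERFECT WITHIN-LEVEL SAMPLING THE LEVEL LAW IS THE SAME IDENTITY**: for
`stPerfectWithinLevel ∘ₖ stLevelKernel` (`K ≥ 1`), `ρ_lev(1) = 1 − 3ā_K/(K(K+2))`. [ours] -/
theorem stPerfect_level_lagOneAutocorr_eq (hXm : Measurable X) (hXb : ∃ C, ∀ x, |X x| ≤ C) (hK : 1 ≤ K) :
    (autocov (stPerfectWithinLevel X μ β K ∘ₖ stLevelKernel hXm μ β K) (stTarget X μ β K)
          (fun z => (((z.1 : Fin (K + 1)) : ℕ) : ℝ)) 1 - ((K : ℝ) / 2) ^ 2) / (K * (K + 2) / 12) =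
      1 - 3 * (2 / (K + 1) * ∑ k ∈ range K, ∫ x, min (Real.exp (β k * X x) / mgf X μ (β k))
        (Real.exp (β (k + 1) * X x) / mgf X μ (β (k + 1))) ∂μ) / (K * (K + 2)) := by
  haveI : ∀ k : Fin (K + 1), IsProbabilityMeasure (μ.tilted fun x => β k * X x) := fun k =>
    isProbabilityMeasure_tilted_mul (μ := μ) hXm hXb (β k)
  exact stScan_level_lagOneAutocorr_eq hXm hXb hK _

/-- **AND THE `τ_int` FLOOR STANDS**: random scan `t·L + (1−t)·stPerfectWithinLevel` on the uniform ladder from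
`a` to `b > a`, floor `0 < m ≤ Var_{μ_u}(X)` on `[a, b]`, `K ≥ 1`, summable level autocorrelations with
`ρ(1) < 1`: `e·m·(b−a)²/96 − ½ ≤ τ_int(level)`. [ours] -/
theorem stPerfect_level_tauInt_ge_kfree (hXm : Measurable X) (hXb : ∃ C, ∀ x, |X x| ≤ C) {a b m : ℝ}
    (hab : a < b) (hm0 : 0 < m) (hm : ∀ u ∈ Icc a b, m ≤ variance X (μ.tilted fun x => u * X x)) (hK : 1 ≤ K)
    (t : unitInterval)
    (hs : Summable fun n =>
      autocov (mixtureKernel t (stLevelKernel hXm μ (fun k => a + k * ((b - a) / K)) K)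
          (stPerfectWithinLevel X μ (fun k => a + k * ((b - a) / K)) K))
        (stTarget X μ (fun k => a + k * ((b - a) / K)) K) (fun z => (((z.1 : Fin (K + 1)) : ℕ) : ℝ) - K / 2) (n + 1) /
      autocov (mixtureKernel t (stLevelKernel hXm μ (fun k => a + k * ((b - a) / K)) K)
          (stPerfectWithinLevel X μ (fun k => a + k * ((b - a) / K)) K))
        (stTarget X μ (fun k => a + k * ((b - a) / K)) K) (fun z => (((z.1 : Fin (K + 1)) : ℕ) : ℝ) - K / 2) 0)
    (hρ : autocov (mixtureKernel t (stLevelKernel hXm μ (fun k => a + k * ((b - a) / K)) K)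
          (stPerfectWithinLevel X μ (fun k => a + k * ((b - a) / K)) K))
        (stTarget X μ (fun k => a + k * ((b - a) / K)) K) (fun z => (((z.1 : Fin (K + 1)) : ℕ) : ℝ) - K / 2) 1 /
      autocov (mixtureKernel t (stLevelKernel hXm μ (fun k => a + k * ((b - a) / K)) K)
          (stPerfectWithinLevel X μ (fun k => a + k * ((b - a) / K)) K))
        (stTarget X μ (fun k => a + k * ((b - a) / K)) K) (fun z => (((z.1 : Fin (K + 1)) : ℕ) : ℝ) - K / 2) 0 < 1) :
    Real.exp 1 * m * (b - a) ^ 2 / 96 - 1 / 2 ≤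
      tauInt (fun n =>
        autocov (mixtureKernel t (stLevelKernel hXm μ (fun k => a + k * ((b - a) / K)) K)
            (stPerfectWithinLevel X μ (fun k => a + k * ((b - a) / K)) K))
          (stTarget X μ (fun k => a + k * ((b - a) / K)) K) (fun z => (((z.1 : Fin (K + 1)) : ℕ) : ℝ) - K / 2) n /
        autocov (mixtureKernel t (stLevelKernel hXm μ (fun k => a + k * ((b - a) / K)) K)
            (stPerfectWithinLevel X μ (fun k => a + k * ((b - a) / K)) K))
          (stTarget X μ (fun k => a + k * ((b - a) / K)) K) (fun z => (((z.1 : Fin (K + 1)) : ℕ) : ℝ) - K / 2) 0) := by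
  haveI : ∀ k : Fin (K + 1), IsProbabilityMeasure (μ.tilted fun x => (a + k * ((b - a) / K)) * X x) := fun k =>
    isProbabilityMeasure_tilted_mul (μ := μ) hXm hXb _
  exact stMix_level_tauInt_ge_kfree hXm hXb hab hm0 hm hK t _ (fun k => isReversible_kernelConst _) hs hρ

end ST

/-! ## §3 Replica exchange with every replica redrawn independently -/

section PT

variable {Ω : Type*} [MeasurableSpace Ω] {X : Ω → ℝ} {K : ℕ}

/-- **Perfect replica updates**: pick a replica uniformly and replace it by an independent draw from the law of
its own level, `μ_{β_k}` (the ideal of a trivializing flow at every coupling). [ours] -/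
def ptPerfectUpdate (hXm : Measurable X) (hXb : ∃ C, ∀ x, |X x| ≤ C) (μ : Measure Ω) [IsProbabilityMeasure μ]
    (β : ℕ → ℝ) (K : ℕ) : Kernel (Fin (K + 1) × (Fin (K + 1) → Ω)) (Fin (K + 1) × (Fin (K + 1) → Ω)) :=
  haveI : ∀ k : Fin (K + 1), IsProbabilityMeasure (μ.tilted fun x => β k * X x) := fun k =>
    isProbabilityMeasure_tilted_mul (μ := μ) hXm hXb (β k)
  ptRandomUpdate fun k : Fin (K + 1) => Kernel.const Ω (μ.tilted fun x => β k * X x)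

variable {μ : Measure Ω} [IsProbabilityMeasure μ]

/-- **REPLICA EXCHANGE WITH PERFECT REPLICA UPDATES STILL OBEYS THE `τ_int` FLOOR**: random scan
`t·ptSwapKernel + (1−t)·ptPerfectUpdate` on the uniform ladder from `a` to `b > a`, floor `0 < m ≤ Var_{μ_u}(X)`,
`K ≥ 1`, summable tag autocorrelations with `ρ(1) < 1`: `e·m·(b−a)²/48 − ½ ≤ τ_int(tag)`. [ours] -/
theorem ptPerfect_level_tauInt_ge_kfree (hXm : Measurable X) (hXb : ∃ C, ∀ x, |X x| ≤ C) {a b m : ℝ}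
    (hab : a < b) (hm0 : 0 < m) (hm : ∀ u ∈ Icc a b, m ≤ variance X (μ.tilted fun x => u * X x)) (hK : 1 ≤ K)
    (t : unitInterval)
    (hs : Summable fun n =>
      autocov (mixtureKernel t (ptSwapKernel hXm (fun k => a + k * ((b - a) / K)) K)
          (ptPerfectUpdate hXm hXb μ (fun k => a + k * ((b - a) / K)) K))
        (ptTaggedTarget X μ (fun k => a + k * ((b - a) / K)) K) (fun z => (((z.1 : Fin (K + 1)) : ℕ) : ℝ) - K / 2)
        (n + 1) /
      autocov (mixtureKernel t (ptSwapKernel hXm (fun k => a + k * ((b - a) / K)) K)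
          (ptPerfectUpdate hXm hXb μ (fun k => a + k * ((b - a) / K)) K))
        (ptTaggedTarget X μ (fun k => a + k * ((b - a) / K)) K) (fun z => (((z.1 : Fin (K + 1)) : ℕ) : ℝ) - K / 2) 0)
    (hρ : autocov (mixtureKernel t (ptSwapKernel hXm (fun k => a + k * ((b - a) / K)) K)
          (ptPerfectUpdate hXm hXb μ (fun k => a + k * ((b - a) / K)) K))
        (ptTaggedTarget X μ (fun k => a + k * ((b - a) / K)) K) (fun z => (((z.1 : Fin (K + 1)) : ℕ) : ℝ) - K / 2) 1 /
      autocov (mixtureKernel t (ptSwapKernel hXm (fun k => a + k * ((b - a) / K)) K)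
          (ptPerfectUpdate hXm hXb μ (fun k => a + k * ((b - a) / K)) K))
        (ptTaggedTarget X μ (fun k => a + k * ((b - a) / K)) K) (fun z => (((z.1 : Fin (K + 1)) : ℕ) : ℝ) - K / 2) 0
        < 1) :
    Real.exp 1 * m * (b - a) ^ 2 / 48 - 1 / 2 ≤
      tauInt (fun n =>
        autocov (mixtureKernel t (ptSwapKernel hXm (fun k => a + k * ((b - a) / K)) K)
            (ptPerfectUpdate hXm hXb μ (fun k => a + k * ((b - a) / K)) K))
          (ptTaggedTarget X μ (fun k => a + k * ((b - a) / K)) K) (fun z => (((z.1 : Fin (K + 1)) : ℕ) : ℝ) - K / 2)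
          n /
        autocov (mixtureKernel t (ptSwapKernel hXm (fun k => a + k * ((b - a) / K)) K)
            (ptPerfectUpdate hXm hXb μ (fun k => a + k * ((b - a) / K)) K))
          (ptTaggedTarget X μ (fun k => a + k * ((b - a) / K)) K) (fun z => (((z.1 : Fin (K + 1)) : ℕ) : ℝ) - K / 2)
          0) := by
  haveI : ∀ k : Fin (K + 1), IsProbabilityMeasure (μ.tilted fun x => (a + k * ((b - a) / K)) * X x) := fun k =>
    isProbabilityMeasure_tilted_mul (μ := μ) hXm hXb _
  exact ptRandom_level_tauInt_ge_kfree hXm hXb hab hm0 hm hK t _ (fun k => isReversible_kernelConst _) hs hρ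

end PT

end Summit.Ventures.LatticeQCDFlow.Scaling

end
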